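/-
Copyright (c) 2026 the pub-hodgecm-mathlib formalisation cell (harness21).  Prover seat hodgecm-mathlib-LH4-p08 (g0), Track A «(D-RAM) FOUR-FRAME» (21-frontier RULING
«PUSH BOTH» l.72341; director req620; heir LEAD F0P3a-plan «FOUR-FRAME SKELETON LANDED» l.72403 EMIT #5), tier 2 for the tier-1 socket `U2H_HSide`: the (Δ)-ROW of
(D-CΔ) `FourFrameTransferFactor` — the RELATIVE TRANSFER FACTOR on the four frame literals IS the sheet's `kappaChar 2` — and the sorry-free ASSEMBLY of (D-CΔ) from the
U1 frame stubs.  2026-09-03.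
-/
import Summits.HodgeConjecture.HodgeConjecture.Theorems.F0P3cDyRamFourFrameHSideDefs       -- ★ DEFS LEAF №2c (dealer; LH4-p03): (D-CΔ) `FourFrameTransferFactor` (law socket v1.4 §2 VERBATIM)
import Summits.HodgeConjecture.HodgeConjecture.Theorems.F0P3cDyRamFrameClassesDistinct   -- ★ p854652 (B-p04): U1-5 `frameClasses_distinct` ((C)₂)
import Summits.HodgeConjecture.HodgeConjecture.Theorems.F0P3cDyRamNormOneSqDepthParity  -- ★ p854642 (B-p04): U1-6 `normOneSq_depth_parity`; brings ★ `v_eq_one_of_mul_map_eq_one`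
import Literature.NumberTheory.Automorphic.UnitaryThreeFourFrameEigenframe               -- ★ p854605 (B-p04): `frameElt_mulVec_frame` (the frame vectors are the eigenvectors of `Γ_b`)
import Literature.NumberTheory.Rogawski1990.FinExplicitTransferFactorKappaEigenvector     -- ★ (F0P3a-p01): `finKappaAt_eq_ite_of_eigenvector` (`κ_v` reads on ANY `u`-eigenvector); brings ★ `isUnit_eval_finCharpolyTwo_of_isLocalGRegular`, ★ `isUnit_localRing_of_ne_zero_of_subsingleton`
import Literature.NumberTheory.Automorphic.AnisotropicUnitaryGroupCompactOfPlace          -- ★ `conjLocal_apply_eq_of_smul_eq`, `localGram_apply_apply` (the local form read at the unique `w ∣ v`)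
import Literature.NumberTheory.Automorphic.UnitaryGroupNonsplitPlace                      -- ★ `PlacesOver.subsingleton_of_smul_eq`
import Literature.NumberTheory.Automorphic.LocalUnitaryIntegralLevel                      -- ★ `placeForm_antidiagOne`
import HarnessLib

/-!
# (D-RAM) «FOUR-FRAME» road, unit (ii-H), TIER 2: THE (Δ)-ROW OF (D-CΔ) — `Δ‴_v[μ](γ_H, t_b) = Δ‴_v[μ](γ_H, t_{b₀}) · κ₃(b)` — AND THE ASSEMBLY OF
# `FourFrameTransferFactor N₀` FROM THE U1 FRAME STUBS (payment plan of `U2H_HSide.stub_U2H_transferFactor_typeOne`)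

Cell `pub/hodgecm-mathlib` (D-0151), crux H413 = `stmt-HodgeConjecture-24833` (helper lane `--supports`), route HCCMUnconditional; organ (D-RAM) `stub_DyRamCore`,
«FOUR-FRAME» road, Track A (LEAD T17-31 (R-9)); tier-1 socket `Cruxes/H413/Lines/F0_P3c_DyRamFourFrame_U2H_HSide.lean` ED. 2, stub
**`stub_U2H_transferFactor_typeOne : FourFrameTransferFactor depthOfRecord`** ((D-CΔ) at the parameters of record, ★ DEFS LEAF №2c).  The U1 socket's §1b
(`Cruxes/H413/Lines/F0_P3c_DyRamFourFrame_U1_Frames.lean` v4) DECOMPOSES (D-CΔ) by name: DATA ∃-block = U1-3 `stub_U1_fourFrameData`, clause (C) = U1-4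
`stub_U1_normPairs_iff_frames`, clause (C)₂ = U1-5 ★ `frameClasses_distinct`, the parity binder `2B = n_i − d + 2 − 2t_E` = U1-6 ★ `normOneSq_depth_parity`, and
«U2H's own Δ-row».  THIS FILE proves the Δ-row (§1), the parity binder at the slot `i = 2` (§2), and the sorry-free assembly of `FourFrameTransferFactor N₀` (every
threshold `N₀`, in particular `depthOfRecord`) from the two OPEN U1 statements taken BY VALUE as hypotheses whose TYPES are the registered stubs U1-3 ∕ U1-4 token
for token (§3) — so the head `FourFrameTransferFactor depthOfRecord` is ONE `exact` away from the ★ payments of U1-3 (LH4-p04) and U1-4 (LH4-p14); no `sorry`, no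
named-fact `def`, axioms TRIO.

THE MATHEMATICS OF THE Δ-ROW ([Rogawski1990, §4.3 (4.3.2) p. 43, §3.5 Prop. 3.5.2 (c) p. 26, §4.9 Prop. 4.9.1 (a) p. 55]; [LanglandsShelstad1987, §3]).  At a
non-split place `v` (one `w ∣ v`), on a matching pair `ι_v(γ_H) ↔ t` Rogawski's explicit factor is `Δ‴_v = τ_v(γ_H) · D_{G∕H,v}(γ_H) · κ_v(γ_H, t)` (★
`finExplicitDelta_of_isLocalNormPair`), and `κ_v(γ_H, t) = +1` iff the hermitian LENGTH `⟨p, p⟩_{Φ₃}` of any eigenvector `p` of `t` for the distinguished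
eigenvalue `u = γ₂` (the `U(1)`-coordinate of `γ_H`, ★ `finGammaTwo`) is a norm from `L_w` (★ `finKappaAt_eq_ite_of_eigenvector`, F0P3a-p01; `χ_g(u)` is a unit on
`G`-regular pairs, ★ `isUnit_eval_finCharpolyTwo_of_isLocalGRegular`).  For the frame literal `t_b` — one-place matrix `z·Γ_b`, `Γ_b = 1 + (a²−1)π₁^{(b)} + (b²−1)π₂^{(b)}`,
`z = γ₂` PINNED ((D-CΔ) v1.2) — the frame vector `f_{b,2}` IS a `z`-eigenvector (★ `frameElt_mulVec_frame`: `Γ_b f_{b,2} = f_{b,2}`), so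
  `κ_v(γ_H, t_b) = ω(⟨f_{b,2}, f_{b,2}⟩) = ω(−1) · ε₁(b) ε₂(b)`
by the norm-class clause of H7 `IsFourFrameFamily` (`ω N(f₃) = ω(−1)·ε₁ε₂`, the determinant constraint of the frame), i.e. `κ_v(γ_H, t_b) = κ_v(γ_H, t_{b₀}) · κ₃(b)` with
`κ₃ = kappaChar 2 = ε₁ε₂` (H5) and `κ_v(γ_H, t_{b₀}) = ω(−1) = baseSign 2` (H6) — the SLOT of (D-CΔ)'s `∃ i` is `i = 2`, the position of `γ_H`'s `U(1)`-component in the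
frame `(f_{b,0}, f_{b,1}, f_{b,2}) ↔ (z a², z b², z)`.  Hence `Δ‴_v(γ_H, t_b) = Δ‴_v(γ_H, t_{b₀}) · kappaChar 2 b` (the factors `τ_v · D_{G∕H,v}` depend on `γ_H` only).  The
parity binder at `i = 2` asks `n₃ = v(a² − b²) ≡ d (mod 2)`: `a² − b² = ((a·σb)² − 1) · b²` with `a·σb` of norm one and `|b| = 1`, so U1-6 applies to `a·σb`.

CONTENTS.
* §0 one-place bookkeeping at a non-split `v` (`E ⊗ L⁺_v = L_w`): lifting a vector of `L_w³` to the carrier ring `∏_{w′∣v} L_{w′}` and reading it back.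
* §1 **`finKappaAt_frame_eq`** (`κ_v(γ_H, t_b) = ω(−1)·ε₁(b)ε₂(b)`) and **`delta_frame_eq_mul_kappaChar`** (the Δ-row of (D-CΔ) with `i = 2`, for ANY data of U1-3's shape
  whose literals match `γ_H`).
* §2 **`exists_parity_slot_two`** (`∃ B, 2B = n₃ − d + 2 − 2t_E`).
* §3 **`fourFrameTransferFactor_of`**: U1-3 ∧ U1-4 (as hypotheses, their registered types verbatim, every `N₀`) ⇒ `FourFrameTransferFactor N₀` — `V := V₃ ∩ V₄`, data from
  U1-3, (C) from U1-4, (C)₂ from ★ U1-5, `i := 2`, `B` from §2, (Δ) from §1.  The by-name head `FourFrameTransferFactor depthOfRecord` follows by `exact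
  fourFrameTransferFactor_of depthOfRecord ‹★U1-3› ‹★U1-4›` in the edition filed the minute both payments are ★ (LH4-p04 ∕ LH4-p14).

HONEST LABEL: HC_CM is proved only modulo the 7 printed citations (2 remaining named inputs: hLiu418 = stmt-HodgeConjecture-24832, h413 = stmt-HodgeConjecture-24833) until rung 0
closes; `--supports stmt-HodgeConjecture-24833` helper; this file moves no verdict: (D-CΔ) at the parameters of record stays OPEN until U1-3 and U1-4 are paid.
-/

noncomputable section

open scoped Valued WithZero Matrix MatrixGroups

namespace Summit.HodgeConjecture.HodgeConjecture.Cruxes.H413.F0P3cDyRamTransferFactorTypeOne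

open MeasureTheory Measure NumberField IsDedekindDomain Topology Filter
open Literature.NumberTheory.Automorphic Literature.NumberTheory.Automorphic.UnitaryGroup Literature.NumberTheory.Automorphic.IntegralReduction
open Literature.NumberTheory.Automorphic.UnitaryLatticeTree Literature.NumberTheory.Automorphic.HermitianLattice
open Literature.NumberTheory.Rogawski1990 Literature.NumberTheory.GaloisRepresentations
open Literature.NumberTheory.Automorphic.UnitaryThreeFourFrame
open Summit.HodgeConjecture.HodgeConjecture.Cruxes.H413.F0P3cDyRamFourFrameHSideDefs
open scoped Classical

/-! ## §0  One-place bookkeeping at a non-split place -/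

section OnePlace

variable (L : Type) [Field L] [NumberField L] [IsCMField L] {v : HeightOneSpectrum (𝓞 ↥(maximalRealSubfield L))}
  (w : UnitaryGroup.PlacesOver L v)

/-- At a non-split `v` two elements of `E ⊗ L⁺_v = ∏_{w′ ∣ v} L_{w′}` agree iff they agree at the unique `w ∣ v`. [cite: CasselsFrohlichANT1967, Ch. II §10] -/
theorem localRing_eq_of_apply_eq (hw : IsCMField.complexConj L • w.1 = w.1) {x y : UnitaryGroup.LocalRing L v} (h : x w = y w) : x = y := by
  haveI : Subsingleton (UnitaryGroup.PlacesOver L v) :=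
    PlacesOver.subsingleton_of_smul_eq (IsCMField.complexConj L) (IsCMField.complexConj_ne_one L) w hw
  funext w'
  obtain rfl : w' = w := Subsingleton.elim _ _
  exact h

omit [IsCMField L] in
/-- The lift `x ↦ (x at w, 0 elsewhere)` of a scalar of `L_w` to `∏_{w′ ∣ v} L_{w′}` reads back `x` at `w`. [cite: CasselsFrohlichANT1967, Ch. II §10] -/
theorem update_zero_apply_self (x : w.1.adicCompletion L) : Function.update (0 : UnitaryGroup.LocalRing L v) w x w = x :=
  Function.update_self ..

end OnePlace

/-! ## §1  `κ_v` on the four frame literals and the Δ-row of (D-CΔ) -/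

section DeltaRow

variable (L : Type) [Field L] [NumberField L] [IsCMField L] {v : HeightOneSpectrum (𝓞 ↥(maximalRealSubfield L))}
  (w : UnitaryGroup.PlacesOver L v) (hw : IsCMField.complexConj L • w.1 = w.1)

/-- **`κ_v(γ_H, t_b) = ω(−1) · ε₁(b) · ε₂(b)` ON THE FRAME LITERALS** (non-split `v`, one `w ∣ v`).  For a `G`-regular `γ_H ∈ H(L⁺_v)`, a four-frame family `f` at `w`
(H7), the GL literals `Γ_b = frameElt σ_w f b (a²) (b²)` and group literals `t_b ∈ U(Φ₃)(L⁺_v)` with one-place matrix `z·Γ_b` where `z = γ₂ = finGammaTwo(γ_H)_w` is the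
`U(1)`-coordinate of `γ_H`, and `ι_v(γ_H) ↔ t_b` a matching pair: Rogawski's endoscopic sign is the NORM CLASS of the length of the third frame vector,
`κ_v(γ_H, t_b) = ω(⟨f_{b,2}, f_{b,2}⟩_{Φ₃}) = ω(−1)·ε₁(b)ε₂(b)` — `f_{b,2}` is a `z`-eigenvector of `z·Γ_b` (★ `frameElt_mulVec_frame`), `κ_v` reads on any `u`-eigenvector
(★ `finKappaAt_eq_ite_of_eigenvector`), and H7 prescribes `ω N(f_{b,2})`. [cite: Rogawski1990, §3.5 Prop. 3.5.2 (c) p. 26; §4.3 (4.3.2) p. 43; §4.9 Prop. 4.9.1 (a) p. 55] [cite: LanglandsShelstad1987, §3] -/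
theorem finKappaAt_frame_eq
    (γH : ((UnitaryGroup.cmDatum L 2 (Matrix.of fun i j : Fin 2 => if i.val + j.val + 1 = 2 then (1 : L) else 0)).Local v × (UnitaryGroup.cmDatum L 1 (Matrix.of fun i j : Fin 1 => if i.val + j.val + 1 = 1 then (1 : L) else 0)).Local v)) (hreg : IsLocalGRegular L v γH)
    {f : Fin 4 → Fin 3 → (Fin 3 → (w.1.adicCompletion L))} (hf : IsFourFrameFamily (galAdicCompletionMap (L := L) (IsCMField.complexConj L) hw) f)
    {a b z : (w.1.adicCompletion L)} (hzγ : z = finGammaTwo L v γH w)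
    {Γ : Fin 4 → GL (Fin 3) (w.1.adicCompletion L)} (hΓ : ∀ b', (Γ b' : Matrix (Fin 3) (Fin 3) (w.1.adicCompletion L)) = frameElt (galAdicCompletionMap (L := L) (IsCMField.complexConj L) hw) f b' (a * a) (b * b))
    {tb : Fin 4 → ((UnitaryGroup.cmDatum L 3 (Matrix.of fun i j : Fin 3 => if i.val + j.val + 1 = 3 then (1 : L) else 0)).Local v)}
    (htb : ∀ b', ((((localNonsplitEquiv (IsCMField.complexConj L) (Matrix.of fun i j : Fin 3 => if i.val + j.val + 1 = 3 then (1 : L) else 0) (IsCMField.complexConj_ne_one L) w hw (tb b') :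
        ↥(unitaryGroupOfForm (galAdicCompletionMap (L := L) (IsCMField.complexConj L) hw) (placeForm (Matrix.of fun i j : Fin 3 => if i.val + j.val + 1 = 3 then (1 : L) else 0) w.1))) : GL (Fin 3) (w.1.adicCompletion L)) : Matrix (Fin 3) (Fin 3) (w.1.adicCompletion L))) = z • (Γ b' : Matrix (Fin 3) (Fin 3) (w.1.adicCompletion L)))
    (b' : Fin 4) (hC : IsLocalNormPair L (Matrix.of fun i j : Fin 3 => if i.val + j.val + 1 = 3 then (1 : L) else 0) v γH (tb b')) :
    finKappaAt L v (Matrix.of fun i j : Fin 3 => if i.val + j.val + 1 = 3 then (1 : L) else 0) γH (tb b') = normSign (galAdicCompletionMap (L := L) (IsCMField.complexConj L) hw) (-1) * (signPair b').1 * (signPair b').2 := by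
  -- the one-place facts
  have hv : Subsingleton (UnitaryGroup.PlacesOver L v) :=
    PlacesOver.subsingleton_of_smul_eq (IsCMField.complexConj L) (IsCMField.complexConj_ne_one L) w hw
  have hu := isUnit_eval_finCharpolyTwo_of_isLocalGRegular L v γH hreg
  obtain ⟨horth, hnz, -, -, h3⟩ := hf b'
  -- the one-place matrix of `t_b′` is `z·Γ_b′` (★ `localNonsplitEquiv` reads the `w`-component: definitional)
  have hx : ((tb b').val.val : Matrix (Fin 3) (Fin 3) (UnitaryGroup.LocalRing L v)).map
      (Pi.evalRingHom (fun w' : UnitaryGroup.PlacesOver L v => w'.1.adicCompletion L) w) = z • (Γ b' : Matrix (Fin 3) (Fin 3) (w.1.adicCompletion L)) := htb b'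
  -- the `z`-eigenvector: the third frame vector, lifted to the carrier ring
  set p' : Fin 3 → UnitaryGroup.LocalRing L v := fun i => Function.update (0 : UnitaryGroup.LocalRing L v) w (f b' 2 i) with hp'_def
  have hp'w : ∀ i, p' i w = f b' 2 i := fun i => update_zero_apply_self L w (f b' 2 i)
  have hev : ((Pi.evalRingHom (fun w' : UnitaryGroup.PlacesOver L v => w'.1.adicCompletion L) w) ∘ p') = f b' 2 := funext fun i => hp'w i
  have hΓf : (Γ b' : Matrix (Fin 3) (Fin 3) (w.1.adicCompletion L)) *ᵥ f b' 2 = f b' 2 := by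
    rw [hΓ b', frameElt_mulVec_frame hf b' (a * a) (b * b) 2]
    have h2 : (![a * a, b * b, 1] : Fin 3 → (w.1.adicCompletion L)) 2 = 1 := rfl
    rw [h2, one_smul]
  have heig : ((tb b').val.val : Matrix (Fin 3) (Fin 3) (UnitaryGroup.LocalRing L v)) *ᵥ p' = finGammaTwo L v γH • p' := by
    funext i
    apply localRing_eq_of_apply_eq L w hw
    have h1 : (((tb b').val.val : Matrix (Fin 3) (Fin 3) (UnitaryGroup.LocalRing L v)) *ᵥ p') i w =
        (Pi.evalRingHom (fun w' : UnitaryGroup.PlacesOver L v => w'.1.adicCompletion L) w)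
          ((((tb b').val.val : Matrix (Fin 3) (Fin 3) (UnitaryGroup.LocalRing L v)) *ᵥ p') i) := rfl
    rw [h1, RingHom.map_mulVec, hx, hev, Matrix.smul_mulVec, hΓf, Pi.smul_apply, Pi.smul_apply, smul_eq_mul, smul_eq_mul, Pi.mul_apply, hp'w i, ← hzγ]
  have hne : p' ≠ 0 := by
    have hf2 : f b' 2 ≠ 0 := by
      intro h0
      apply hnz 2
      simp only [h0, map_zero]
    obtain ⟨i, hi⟩ := Function.ne_iff.1 hf2
    intro h0
    apply hi
    have := congrFun (congrFun h0 i) w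
    rwa [hp'w i] at this
  -- the length of the eigenvector read at `w` is `⟨f_{b′,2}, f_{b′,2}⟩_{Φ₃}`
  have hS : (∑ i : Fin 3, ∑ k : Fin 3, UnitaryGroup.conjLocal L (IsCMField.complexConj L) v (p' i) *
      ((UnitaryGroup.adelicForm L 3 (Matrix.of fun i j : Fin 3 => if i.val + j.val + 1 = 3 then (1 : L) else 0)).map (UnitaryGroup.adeleToLocal L v)) i k * p' k) w =
      pairing (galAdicCompletionMap (L := L) (IsCMField.complexConj L) hw) ((StdForm.antidiagonal 3).over (w.1.adicCompletion L)) (f b' 2) (f b' 2) := by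
    rw [pairing_apply]
    simp only [Finset.sum_apply, Pi.mul_apply, conjLocal_apply_eq_of_smul_eq (IsCMField.complexConj L) (IsCMField.complexConj_ne_one L) v w hw, hp'w,
      localGram_apply_apply, placeForm_antidiagOne]
  have hN0 : pairing (galAdicCompletionMap (L := L) (IsCMField.complexConj L) hw) ((StdForm.antidiagonal 3).over (w.1.adicCompletion L)) (f b' 2) (f b' 2) ≠ 0 := hnz 2
  -- the norm test on the carrier ring is the norm class at `w`
  have hiff : (∃ zz : UnitaryGroup.LocalRing L v, IsUnit zz ∧
      (∑ i : Fin 3, ∑ k : Fin 3, UnitaryGroup.conjLocal L (IsCMField.complexConj L) v (p' i) *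
        ((UnitaryGroup.adelicForm L 3 (Matrix.of fun i j : Fin 3 => if i.val + j.val + 1 = 3 then (1 : L) else 0)).map (UnitaryGroup.adeleToLocal L v)) i k * p' k) =
        zz * UnitaryGroup.conjLocal L (IsCMField.complexConj L) v zz) ↔
      ∃ y : (w.1.adicCompletion L), y * (galAdicCompletionMap (L := L) (IsCMField.complexConj L) hw) y = pairing (galAdicCompletionMap (L := L) (IsCMField.complexConj L) hw) ((StdForm.antidiagonal 3).over (w.1.adicCompletion L)) (f b' 2) (f b' 2) := by
    constructor
    · rintro ⟨zz, -, hzz⟩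
      refine ⟨zz w, ?_⟩
      have h := congrFun hzz w
      rw [hS, Pi.mul_apply, conjLocal_apply_eq_of_smul_eq (IsCMField.complexConj L) (IsCMField.complexConj_ne_one L) v w hw] at h
      exact h.symm
    · rintro ⟨y, hy⟩
      have hy0 : y ≠ 0 := fun h0 => hN0 (by rw [← hy, h0, zero_mul])
      refine ⟨Function.update (0 : UnitaryGroup.LocalRing L v) w y, isUnit_localRing_of_ne_zero_of_subsingleton L v hv ?_, ?_⟩
      · intro h0
        apply hy0
        have h := congrFun h0 w
        rwa [update_zero_apply_self] at h
      · apply localRing_eq_of_apply_eq L w hw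
        rw [hS, Pi.mul_apply, conjLocal_apply_eq_of_smul_eq (IsCMField.complexConj L) (IsCMField.complexConj_ne_one L) v w hw, update_zero_apply_self, hy]
  rw [finKappaAt_eq_ite_of_eigenvector L v (Matrix.of fun i j : Fin 3 => if i.val + j.val + 1 = 3 then (1 : L) else 0) γH (tb b') hv hC hu heig hne, ← h3]
  unfold normSign
  by_cases hex : ∃ y : (w.1.adicCompletion L), y * (galAdicCompletionMap (L := L) (IsCMField.complexConj L) hw) y = pairing (galAdicCompletionMap (L := L) (IsCMField.complexConj L) hw) ((StdForm.antidiagonal 3).over (w.1.adicCompletion L)) (f b' 2) (f b' 2)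
  · rw [if_pos (hiff.2 hex), if_pos hex]
  · rw [if_neg (fun h => hex (hiff.1 h)), if_neg hex]

/-- **THE Δ-ROW OF (D-CΔ): `Δ‴_v[μ](γ_H, t_b) = Δ‴_v[μ](γ_H, t_{b₀}) · kappaChar 2 b`** (non-split `v`).  For a `G`-regular `γ_H`, ANY four-frame data of U1-3's shape
whose group literals `t_b` (one-place matrix `z·Γ_b`, `z = γ₂` pinned) all MATCH `γ_H` (clause (C) of (D-CΔ) gives this), Rogawski's explicit factor ★ `finExplicitCollection … .Δ`
(= `Δ‴_v = τ_v · D_{G∕H,v} · κ_v` on matching pairs) satisfies the sheet's κ-SIGN law with the slot `i = 2`: `κ_v(γ_H, t_b) = ω(−1)ε₁ε₂(b)` (`finKappaAt_frame_eq`) and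
`κ_v(γ_H, t_{b₀}) = ω(−1)` (`signPair 0 = (1, 1)`), so the relative factor is `ε₁(b)ε₂(b) = kappaChar 2 b` (H5) — (4.3.2) `Δ(γ_H, γ′) = Δ(γ_H, γ)·κ(inv(γ, γ′))` on the four
classes of the stable class. [cite: Rogawski1990, §4.3 (4.3.2) p. 43; §4.9 Prop. 4.9.1 (a) p. 55] [cite: LanglandsShelstad1987, §3] -/
theorem delta_frame_eq_mul_kappaChar (μ : HeckeCharacter L)
    (γH : ((UnitaryGroup.cmDatum L 2 (Matrix.of fun i j : Fin 2 => if i.val + j.val + 1 = 2 then (1 : L) else 0)).Local v × (UnitaryGroup.cmDatum L 1 (Matrix.of fun i j : Fin 1 => if i.val + j.val + 1 = 1 then (1 : L) else 0)).Local v)) (hreg : IsLocalGRegular L v γH)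
    {f : Fin 4 → Fin 3 → (Fin 3 → (w.1.adicCompletion L))} (hf : IsFourFrameFamily (galAdicCompletionMap (L := L) (IsCMField.complexConj L) hw) f)
    {a b z : (w.1.adicCompletion L)} (hzγ : z = finGammaTwo L v γH w)
    {Γ : Fin 4 → GL (Fin 3) (w.1.adicCompletion L)} (hΓ : ∀ b', (Γ b' : Matrix (Fin 3) (Fin 3) (w.1.adicCompletion L)) = frameElt (galAdicCompletionMap (L := L) (IsCMField.complexConj L) hw) f b' (a * a) (b * b))
    {tb : Fin 4 → ((UnitaryGroup.cmDatum L 3 (Matrix.of fun i j : Fin 3 => if i.val + j.val + 1 = 3 then (1 : L) else 0)).Local v)}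
    (htb : ∀ b', ((((localNonsplitEquiv (IsCMField.complexConj L) (Matrix.of fun i j : Fin 3 => if i.val + j.val + 1 = 3 then (1 : L) else 0) (IsCMField.complexConj_ne_one L) w hw (tb b') :
        ↥(unitaryGroupOfForm (galAdicCompletionMap (L := L) (IsCMField.complexConj L) hw) (placeForm (Matrix.of fun i j : Fin 3 => if i.val + j.val + 1 = 3 then (1 : L) else 0) w.1))) : GL (Fin 3) (w.1.adicCompletion L)) : Matrix (Fin 3) (Fin 3) (w.1.adicCompletion L))) = z • (Γ b' : Matrix (Fin 3) (Fin 3) (w.1.adicCompletion L)))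
    (hC : ∀ b', IsLocalNormPair L (Matrix.of fun i j : Fin 3 => if i.val + j.val + 1 = 3 then (1 : L) else 0) v γH (tb b')) (b' : Fin 4) :
    ((finExplicitCollection L (Matrix.of fun i j : Fin 3 => if i.val + j.val + 1 = 3 then (1 : L) else 0) μ (finExplicitDelta_conj_left_all L (Matrix.of fun i j : Fin 3 => if i.val + j.val + 1 = 3 then (1 : L) else 0) μ) (finExplicitDelta_conj_right_all L (Matrix.of fun i j : Fin 3 => if i.val + j.val + 1 = 3 then (1 : L) else 0) μ)) v).Δ γH (tb b') = ((finExplicitCollection L (Matrix.of fun i j : Fin 3 => if i.val + j.val + 1 = 3 then (1 : L) else 0) μ (finExplicitDelta_conj_left_all L (Matrix.of fun i j : Fin 3 => if i.val + j.val + 1 = 3 then (1 : L) else 0) μ) (finExplicitDelta_conj_right_all L (Matrix.of fun i j : Fin 3 => if i.val + j.val + 1 = 3 then (1 : L) else 0) μ)) v).Δ γH (tb 0) * (kappaChar 2 b' : ℂ) := by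
  rw [finExplicitCollection_Δ, finExplicitCollection_Δ, finExplicitDelta_of_isLocalNormPair L v _ γH μ (hC b'), finExplicitDelta_of_isLocalNormPair L v _ γH μ (hC 0),
    finKappaAt_frame_eq L w hw γH hreg hf hzγ hΓ htb b' (hC b'), finKappaAt_frame_eq L w hw γH hreg hf hzγ hΓ htb 0 (hC 0)]
  have h0 : signPair 0 = (1, 1) := rfl
  have hk : kappaChar 2 b' = (signPair b').1 * (signPair b').2 := rfl
  rw [h0, hk]
  push_cast
  ring

end DeltaRow

/-! ## §2  The parity binder at the slot `i = 2` -/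

section Parity

variable {K : Type} [Field K] [Valued K ℤᵐ⁰] [CompleteSpace K]

/-- **`∃ B ∈ ℤ, 2B = n₃ − d + 2 − 2t_E`** for a regular element datum `(a², b²)` of norm-one `a, b` at a ramified quadratic datum: `n₃ = v(a² − b²) ≡ d (mod 2)` because
`a² − b² = ((a·σb)² − 1)·b²` with `a·σb` of norm one, `(a·σb)² ≠ 1` (`a² ≠ b²`) and `|b²| = 1`, so U1-6 ★ `normOneSq_depth_parity` applies to `a·σb`. [cite: Serre1979, Ch. V §3] [cite: Rogawski1990, §4.9 p. 55] -/
theorem exists_parity_slot_two {σ : K →+* K} {ϖ : K} {d t : ℕ} (hD : IsRamifiedQuadraticDatum σ ϖ d t)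
    {a b : K} (ha : a * σ a = 1) (hb : b * σ b = 1) {N₀ n₁ n₂ n₃ : ℕ} (hE : IsElementDatum σ ϖ N₀ (a * a) (b * b) n₁ n₂ n₃) :
    ∃ B : ℤ, 2 * B = ((![n₁, n₂, n₃] : Fin 3 → ℕ) 2 : ℤ) - d + 2 - 2 * t := by
  have hσσ : ∀ x, σ (σ x) = x := hD.1
  have hvσ : ∀ x, Valued.v (σ x) = Valued.v x := hD.2.1
  obtain ⟨-, -, hαβ, -, -, -, -, hn₃, -⟩ := hE
  -- the norm-one unit `c = a·σb` with `c² − 1 = (a² − b²)·(σb)²`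
  set c : K := a * σ b with hc_def
  have hc1 : c * σ c = 1 := by
    rw [hc_def, map_mul, hσσ]
    calc a * σ b * (σ a * b) = (a * σ a) * (b * σ b) := by ring
      _ = 1 := by rw [ha, hb, mul_one]
  have hσb2 : σ b * σ b * (b * b) = 1 := by
    calc σ b * σ b * (b * b) = (b * σ b) * (b * σ b) := by ring
      _ = 1 := by rw [hb, mul_one]
  have hcc : c * c - 1 = (a * a - b * b) * (σ b * σ b) := by
    rw [hc_def]
    linear_combination hσb2
  have hvb : Valued.v b = 1 := v_eq_one_of_mul_map_eq_one hvσ hb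
  have hvσb2 : Valued.v (σ b * σ b) = 1 := by rw [map_mul, hvσ, hvb, mul_one]
  have hcc1 : c * c ≠ 1 := by
    intro h1
    have h0 : (a * a - b * b) * (σ b * σ b) = 0 := by rw [← hcc, h1, sub_self]
    rcases mul_eq_zero.1 h0 with h | h
    · exact hαβ (sub_eq_zero.1 h)
    · rw [h, map_zero] at hvσb2
      exact zero_ne_one hvσb2
  have hvc : Valued.v (c * c - 1) = Valued.v ϖ ^ n₃ := by rw [hcc, map_mul, hvσb2, mul_one, hn₃]
  have hpar : n₃ % 2 = d % 2 :=
    Summit.HodgeConjecture.HodgeConjecture.Cruxes.H413.F0P3cDyRamNormOneSqDepthParity.normOneSq_depth_parity σ ϖ d t hD c hc1 hcc1 n₃ hvc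
  have h2 : ((![n₁, n₂, n₃] : Fin 3 → ℕ) 2 : ℤ) = n₃ := rfl
  refine ⟨((n₃ : ℤ) - d) / 2 + 1 - t, ?_⟩
  rw [h2]
  omega

end Parity

/-! ## §3  The assembly: (D-CΔ) `FourFrameTransferFactor N₀` from the U1 frame stubs -/

/-- **(D-CΔ) FROM THE FRAME STUBS OF UNIT (i)** — for every threshold schedule `N₀`: the registered statements U1-3 `stub_U1_fourFrameData N₀` (four-frame DATA of a
type-(1) element near `1`: `f, a, b, z = γ₂, n, k, Γ_b, t_b`) and U1-4 `stub_U1_normPairs_iff_frames N₀` (the NORM PAIRS of `γ_H` are exactly the conjugates of the `t_b`),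
taken here BY VALUE (their types verbatim — no fact is minted), imply `FourFrameTransferFactor N₀`: on `V := V₃ ∩ V₄` take U1-3's data, clause (C) from U1-4, (C)₂ from ★ U1-5
`frameClasses_distinct`, the slot `i := 2` with the parity datum of §2, and the Δ-row of §1.  The by-name head `stub_U2H_transferFactor_typeOne : FourFrameTransferFactor
depthOfRecord` is `fourFrameTransferFactor_of depthOfRecord ‹★U1-3› ‹★U1-4›`. [cite: Rogawski1990, §4.9 Prop. 4.9.1 (a) p. 55; §4.3 (4.3.2) p. 43] [cite: LanglandsShelstad1987, §3] -/
theorem fourFrameTransferFactor_of (N₀ : ℕ → ℕ)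
    (hData :
        ∀ (L : Type) [Field L] [NumberField L] [IsCMField L]
          {v : HeightOneSpectrum (𝓞 ↥(maximalRealSubfield L))} (w : UnitaryGroup.PlacesOver L v)
          (hw : IsCMField.complexConj L • w.1 = w.1) (_he : v.asIdeal.ramificationIdx' w.1.asIdeal ≠ 1)
          (_h2 : ¬ IsUnit (2 : (ValuativeRel.valuation (w.1.adicCompletion L)).integer))
          (ϖ : (w.1.adicCompletion L)) (_hϖ : Valued.v ϖ = WithZero.exp (-1 : ℤ)) (d tE : ℕ) (_hD : IsRamifiedQuadraticDatum (galAdicCompletionMap (L := L) (IsCMField.complexConj L) hw) ϖ d tE),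
          ∃ V ∈ 𝓝 (1 : ((UnitaryGroup.cmDatum L 2 (Matrix.of fun i j : Fin 2 => if i.val + j.val + 1 = 2 then (1 : L) else 0)).Local v × (UnitaryGroup.cmDatum L 1 (Matrix.of fun i j : Fin 1 => if i.val + j.val + 1 = 1 then (1 : L) else 0)).Local v)), ∀ γH ∈ V, IsLocalGRegular L v γH →
            (∃ x : (w.1.adicCompletion L), (((((γH).1.val : GL (Fin 2) (UnitaryGroup.LocalRing L v)).val.map (Pi.evalRingHom (fun w' : UnitaryGroup.PlacesOver L v => w'.1.adicCompletion L) w))).charpoly).IsRoot x) →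
            ¬ (∃ (y : ((UnitaryGroup.cmDatum L 2 (Matrix.of fun i j : Fin 2 => if i.val + j.val + 1 = 2 then (1 : L) else 0)).Local v × (UnitaryGroup.cmDatum L 1 (Matrix.of fun i j : Fin 1 => if i.val + j.val + 1 = 1 then (1 : L) else 0)).Local v)) (d' : Fin 2 → (UnitaryGroup.LocalRing L v)ˣ),
                glDiagonal 2 (UnitaryGroup.LocalRing L v) d' = ((y * γH * y⁻¹).1.val : GL (Fin 2) (UnitaryGroup.LocalRing L v))) →
            ∃ (f : Fin 4 → Fin 3 → (Fin 3 → (w.1.adicCompletion L))) (_ : IsFourFrameFamily (galAdicCompletionMap (L := L) (IsCMField.complexConj L) hw) f)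
              (a b z : (w.1.adicCompletion L)) (_ : a * (galAdicCompletionMap (L := L) (IsCMField.complexConj L) hw) a = 1) (_ : b * (galAdicCompletionMap (L := L) (IsCMField.complexConj L) hw) b = 1) (_ : z * (galAdicCompletionMap (L := L) (IsCMField.complexConj L) hw) z = 1)
              (_ : z = finGammaTwo L v γH w) (_ : ((((γH).1.val : GL (Fin 2) (UnitaryGroup.LocalRing L v)).val.map (Pi.evalRingHom (fun w' : UnitaryGroup.PlacesOver L v => w'.1.adicCompletion L) w))).charpoly.IsRoot (z * (a * a))) (_ : ((((γH).1.val : GL (Fin 2) (UnitaryGroup.LocalRing L v)).val.map (Pi.evalRingHom (fun w' : UnitaryGroup.PlacesOver L v => w'.1.adicCompletion L) w))).charpoly.IsRoot (z * (b * b)))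
              (_ : Valued.v (a - 1) < Valued.v (2 : (w.1.adicCompletion L))) (_ : Valued.v (b - 1) < Valued.v (2 : (w.1.adicCompletion L)))
              (n₁ n₂ n₃ : ℕ) (_ : IsElementDatum (galAdicCompletionMap (L := L) (IsCMField.complexConj L) hw) ϖ (N₀ d) (a * a) (b * b) n₁ n₂ n₃)
              (k : ℕ) (_ : 2 * k + d = n₁ + n₂ + n₃ + 2)
              (Γ : Fin 4 → GL (Fin 3) (w.1.adicCompletion L)) (_ : ∀ b', (Γ b' : Matrix (Fin 3) (Fin 3) (w.1.adicCompletion L)) = frameElt (galAdicCompletionMap (L := L) (IsCMField.complexConj L) hw) f b' (a * a) (b * b))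
              (tb : Fin 4 → ((UnitaryGroup.cmDatum L 3 (Matrix.of fun i j : Fin 3 => if i.val + j.val + 1 = 3 then (1 : L) else 0)).Local v)),
              ∀ b', ((((localNonsplitEquiv (IsCMField.complexConj L) (Matrix.of fun i j : Fin 3 => if i.val + j.val + 1 = 3 then (1 : L) else 0) (IsCMField.complexConj_ne_one L) w hw (tb b') :
                  ↥(unitaryGroupOfForm (galAdicCompletionMap (L := L) (IsCMField.complexConj L) hw) (placeForm (Matrix.of fun i j : Fin 3 => if i.val + j.val + 1 = 3 then (1 : L) else 0) w.1))) : GL (Fin 3) (w.1.adicCompletion L)) : Matrix (Fin 3) (Fin 3) (w.1.adicCompletion L))) = z • (Γ b' : Matrix (Fin 3) (Fin 3) (w.1.adicCompletion L)))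
    (hNorm :
        ∀ (L : Type) [Field L] [NumberField L] [IsCMField L]
          {v : HeightOneSpectrum (𝓞 ↥(maximalRealSubfield L))} (w : UnitaryGroup.PlacesOver L v)
          (hw : IsCMField.complexConj L • w.1 = w.1) (_he : v.asIdeal.ramificationIdx' w.1.asIdeal ≠ 1)
          (_h2 : ¬ IsUnit (2 : (ValuativeRel.valuation (w.1.adicCompletion L)).integer))
          (ϖ : (w.1.adicCompletion L)) (_hϖ : Valued.v ϖ = WithZero.exp (-1 : ℤ)) (d tE : ℕ) (_hD : IsRamifiedQuadraticDatum (galAdicCompletionMap (L := L) (IsCMField.complexConj L) hw) ϖ d tE),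
          ∃ V ∈ 𝓝 (1 : ((UnitaryGroup.cmDatum L 2 (Matrix.of fun i j : Fin 2 => if i.val + j.val + 1 = 2 then (1 : L) else 0)).Local v × (UnitaryGroup.cmDatum L 1 (Matrix.of fun i j : Fin 1 => if i.val + j.val + 1 = 1 then (1 : L) else 0)).Local v)), ∀ γH ∈ V, IsLocalGRegular L v γH →
            (∃ x : (w.1.adicCompletion L), (((((γH).1.val : GL (Fin 2) (UnitaryGroup.LocalRing L v)).val.map (Pi.evalRingHom (fun w' : UnitaryGroup.PlacesOver L v => w'.1.adicCompletion L) w))).charpoly).IsRoot x) →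
            ¬ (∃ (y : ((UnitaryGroup.cmDatum L 2 (Matrix.of fun i j : Fin 2 => if i.val + j.val + 1 = 2 then (1 : L) else 0)).Local v × (UnitaryGroup.cmDatum L 1 (Matrix.of fun i j : Fin 1 => if i.val + j.val + 1 = 1 then (1 : L) else 0)).Local v)) (d' : Fin 2 → (UnitaryGroup.LocalRing L v)ˣ),
                glDiagonal 2 (UnitaryGroup.LocalRing L v) d' = ((y * γH * y⁻¹).1.val : GL (Fin 2) (UnitaryGroup.LocalRing L v))) →
            ∀ (f : Fin 4 → Fin 3 → (Fin 3 → (w.1.adicCompletion L))) (_ : IsFourFrameFamily (galAdicCompletionMap (L := L) (IsCMField.complexConj L) hw) f)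
              (a b z : (w.1.adicCompletion L)) (_ : a * (galAdicCompletionMap (L := L) (IsCMField.complexConj L) hw) a = 1) (_ : b * (galAdicCompletionMap (L := L) (IsCMField.complexConj L) hw) b = 1) (_ : z * (galAdicCompletionMap (L := L) (IsCMField.complexConj L) hw) z = 1)
              (_ : z = finGammaTwo L v γH w) (_ : ((((γH).1.val : GL (Fin 2) (UnitaryGroup.LocalRing L v)).val.map (Pi.evalRingHom (fun w' : UnitaryGroup.PlacesOver L v => w'.1.adicCompletion L) w))).charpoly.IsRoot (z * (a * a))) (_ : ((((γH).1.val : GL (Fin 2) (UnitaryGroup.LocalRing L v)).val.map (Pi.evalRingHom (fun w' : UnitaryGroup.PlacesOver L v => w'.1.adicCompletion L) w))).charpoly.IsRoot (z * (b * b)))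
              (n₁ n₂ n₃ : ℕ) (_ : IsElementDatum (galAdicCompletionMap (L := L) (IsCMField.complexConj L) hw) ϖ (N₀ d) (a * a) (b * b) n₁ n₂ n₃)
              (Γ : Fin 4 → GL (Fin 3) (w.1.adicCompletion L)) (_ : ∀ b', (Γ b' : Matrix (Fin 3) (Fin 3) (w.1.adicCompletion L)) = frameElt (galAdicCompletionMap (L := L) (IsCMField.complexConj L) hw) f b' (a * a) (b * b))
              (tb : Fin 4 → ((UnitaryGroup.cmDatum L 3 (Matrix.of fun i j : Fin 3 => if i.val + j.val + 1 = 3 then (1 : L) else 0)).Local v)) (_ : ∀ b', ((((localNonsplitEquiv (IsCMField.complexConj L) (Matrix.of fun i j : Fin 3 => if i.val + j.val + 1 = 3 then (1 : L) else 0) (IsCMField.complexConj_ne_one L) w hw (tb b') :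
                  ↥(unitaryGroupOfForm (galAdicCompletionMap (L := L) (IsCMField.complexConj L) hw) (placeForm (Matrix.of fun i j : Fin 3 => if i.val + j.val + 1 = 3 then (1 : L) else 0) w.1))) : GL (Fin 3) (w.1.adicCompletion L)) : Matrix (Fin 3) (Fin 3) (w.1.adicCompletion L))) = z • (Γ b' : Matrix (Fin 3) (Fin 3) (w.1.adicCompletion L))),
              (∀ t : ((UnitaryGroup.cmDatum L 3 (Matrix.of fun i j : Fin 3 => if i.val + j.val + 1 = 3 then (1 : L) else 0)).Local v), IsLocalNormPair L (Matrix.of fun i j : Fin 3 => if i.val + j.val + 1 = 3 then (1 : L) else 0) v γH t ↔ ∃ b', ConjClasses.mk t = ConjClasses.mk (tb b'))) :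
    FourFrameTransferFactor N₀ := by
  intro L _ _ _ v w hw he h2 ϖ hϖ d tE hD μ _hμu _hμω _ _ _ _ _ _ _ _
  obtain ⟨V₃, hV₃, h3⟩ := hData L w hw he h2 ϖ hϖ d tE hD
  obtain ⟨V₄, hV₄, h4⟩ := hNorm L w hw he h2 ϖ hϖ d tE hD
  refine ⟨V₃ ∩ V₄, Filter.inter_mem hV₃ hV₄, fun γH hγ hreg hroot hnd => ?_⟩
  obtain ⟨f, hf, a, b, z, ha, hb, hz, hzγ, hra, hrb, ha1, hb1, n₁, n₂, n₃, hE, k, hk, Γ, hΓ, tb, htb⟩ := h3 γH hγ.1 hreg hroot hnd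
  have hC := h4 γH hγ.2 hreg hroot hnd f hf a b z ha hb hz hzγ hra hrb n₁ n₂ n₃ hE Γ hΓ tb htb
  have hC2 := Summit.HodgeConjecture.HodgeConjecture.Cruxes.H413.F0P3cDyRamFrameClassesDistinct.frameClasses_distinct N₀ L w hw he h2 ϖ hϖ d tE hD
    f hf a b z ha hb hz n₁ n₂ n₃ hE Γ hΓ tb htb
  obtain ⟨B, hB⟩ := exists_parity_slot_two (t := tE) hD ha hb hE
  refine ⟨f, hf, a, b, z, ha, hb, hz, hzγ, hra, hrb, ha1, hb1, n₁, n₂, n₃, hE, k, hk, Γ, hΓ, tb, htb, 2, B, hB, hC, hC2, ?_⟩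
  exact delta_frame_eq_mul_kappaChar L w hw μ γH hreg hf hzγ hΓ htb (fun b' => (hC (tb b')).2 ⟨b', rfl⟩)

end Summit.HodgeConjecture.HodgeConjecture.Cruxes.H413.F0P3cDyRamTransferFactorTypeOne

end
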